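import Literature.NumberTheory.CubicFields.UniformLandauShintaniSeries
import Literature.NumberTheory.CubicFields.LandauRieszSandwich
import HarnessLib

/-!
# Uniform Landau–Shintani estimates, II: BTT Theorem 3.1 in `y`-form (weak, Bessel-free), uniformly in the level

Topic `Literature/NumberTheory/CubicFields`. Bhargava–Taniguchi–Thorne 2023, Theorem 3.1 (Landau's method for the
Shintani zeta functions `ξ^±(s, Φ_m)`, after [LDTT]) bounds `N^±(X, Φ_m) − Res₁·X − (6/5)Res_{5/6}·X^{5/6}` by
`δ₁^{2/5} δ̂₁^{3/5} X^{3/5}` (when `δ₁X^{13/16} ≥ δ̂₁`). Its proof (§3): Perron's formula of order `k`, the contour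
shift and the functional equation (`ShintaniLandauContour.rieszTheta_eq`), then `k`-th differences `Δ^k_y` and the
sandwich for the nonnegative coefficients, then an optimisation in `y` using the Bessel-function asymptotics of the
kernel ([LDTT] Lemma 6). Mathlib has no Bessel functions; this file PROVES the theorem in the **`y`-form with the
elementary kernel bounds** of `ShintaniLandauKernel.lean` (which cost `X^{2/5} ↦ X^{1/3−O(η)}` in the final exponent —
irrelevant for (3) of BTT, whose error term is `X^{2/3+ε}` anyway), from the schema `HasShintaniFE Φ` and
`btt_uniformity_sqDvd`, uniformly in the level `m` and in `Φ`:

* `exists_landau_yform` — for `0 < η ≤ 1/16` there is `C_η` with: for all `m ≥ 1`, nonnegative real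
  `Φ : V(ℤ/mℤ) → ℂ` with `HasShintaniFE Φ`, `s = ±1`, integers `X ≥ 1`, `0 < y ≤ X/12`,
  `‖N^s(X,Φ_m) − Res₁ξ^s X − (6/5)Res_{5/6}ξ^s X^{5/6}‖
     ≤ C_η [(y+1) Σ_±|Res₁ξ^±| + (y+1) X^{−1/6} Σ_±|Res_{5/6}ξ^±| + δ̂₁(Φ_m)(1 + X^{2+4η} y^{−2−4η})]`
  (`exists_landau_yform_real` is the same at real `u` for `Σ_{n ≤ u}`);
* the steps, all proved: `Δ³_y` of the main terms `X⁴ρ₁/4`, `X^{23/6}ρ_{5/6}K(5/6)`, `X³θ(0)`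
  (`norm_fwdDiff_three_rieszTheta_sub_le`, with `K(5/6)(23/6)(17/6)(11/6) = 36/5` giving the coefficient `6/5`);
  the undoing of the diagonalisation `T` of (eq:FE) (`diagComb`, `fwdDiff_three_rieszTheta_eq_diag`); the abstract
  sandwich step `norm_sub_le_of_sandwich` ([LDTT] (eq:basic_upper)–(eq:basic_lower), including the control of the
  imaginary parts of the residues by the same error); the inputs `θ_cont(0) ≪ δ̂₁` and
  `‖Δ³_y W^ε(u)‖ ≪ δ̂₁ u^{2+4η} y^{1−4η}` are `UniformLandauShintaniSeries.lean`.

## References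

* M. Bhargava, T. Taniguchi, F. Thorne, *Improved error estimates for the Davenport–Heilbronn theorems*,
  Math. Ann. 389 (2024) = arXiv:2107.12819, Thm 3.1 and §3. [BhargavaTaniguchiThorne2023]
* D. Lowry-Duda, T. Taniguchi, F. Thorne, *Uniform bounds for lattice point counting and partial sums of zeta
  functions*, Math. Z. 300 (2022) = arXiv:1710.02190, §2.2. [LowrydudaTaniguchiThorne2017]
-/

noncomputable section

open Complex Real Set Filter MeasureTheory Topology
open Literature.NumberTheory.CubicFields.ShintaniGamma Literature.NumberTheory.CubicFields.LandauContour
  Literature.NumberTheory.CubicFields.LandauShintani Literature.NumberTheory.CubicFields.LandauDiff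

namespace Literature.NumberTheory.CubicFields

namespace LandauShintani

variable {m : ℕ}

/-! ### Third differences of the main terms -/

/-- `Δ³_y (t ↦ t³)(u) = 6y³` exactly (`u > 0`, `y ≥ 0`). [folklore] -/
theorem fwdDiff_three_cpow_three {u y : ℝ} (hu : 0 < u) (hy : 0 ≤ y) :
    ((fwdDiff y)^[3] (fun t : ℝ => (t : ℂ) ^ (3 : ℂ))) u = 6 * (y : ℂ) ^ 3 := by
  have h := norm_fwdDiff_three_cpow_sub_le (3 : ℂ) hu hy
  have h0 : (3 : ℂ) * (3 - 1) * (3 - 2) * (3 - 3) = 0 := by ring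
  rw [h0, norm_zero, zero_mul, mul_zero] at h
  have h1 : (3 : ℂ) * (3 - 1) * (3 - 2) * (u : ℂ) ^ ((3 : ℂ) - 3) * (y : ℂ) ^ 3 = 6 * (y : ℂ) ^ 3 := by
    rw [sub_self, cpow_zero]; ring
  rw [h1] at h
  exact sub_eq_zero.mp (norm_le_zero_iff.mp h)

/-- `Δ³_y (t ↦ t⁴)(u) = 24 u y³ + E`, `|E| ≤ 72 y⁴`. [folklore] -/
theorem norm_fwdDiff_three_cpow_four_sub_le {u y : ℝ} (hu : 0 < u) (hy : 0 ≤ y) :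
    ‖((fwdDiff y)^[3] (fun t : ℝ => (t : ℂ) ^ (4 : ℂ))) u - 24 * (u : ℂ) * (y : ℂ) ^ 3‖ ≤ 72 * y ^ 4 := by
  have h := norm_fwdDiff_three_cpow_sub_le (4 : ℂ) hu hy
  have h1 : (4 : ℂ) * (4 - 1) * (4 - 2) * (u : ℂ) ^ ((4 : ℂ) - 3) * (y : ℂ) ^ 3 = 24 * (u : ℂ) * (y : ℂ) ^ 3 := by
    rw [show (4 : ℂ) - 3 = 1 by norm_num, cpow_one]; ring
  have h2 : ‖(4 : ℂ) * (4 - 1) * (4 - 2) * (4 - 3)‖ = 24 := by norm_num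
  have h3 : max (u ^ ((4 : ℂ).re - 4)) ((u + 3 * y) ^ ((4 : ℂ).re - 4)) = 1 := by norm_num
  rw [h1, h2, h3] at h
  linarith

/-- `Δ³_y (t ↦ t^{23/6})(u) = (23/6)(17/6)(11/6) u^{5/6} y³ + E`, `|E| ≤ 51 y⁴ u^{−1/6}`. [folklore] -/
theorem norm_fwdDiff_three_cpow_sub_le' {u y : ℝ} (hu : 0 < u) (hy : 0 ≤ y) :
    ‖((fwdDiff y)^[3] (fun t : ℝ => (t : ℂ) ^ ((23 : ℂ) / 6))) u
        - (23 / 6 * (17 / 6) * (11 / 6) : ℂ) * ((u ^ ((5 : ℝ) / 6) : ℝ) : ℂ) * (y : ℂ) ^ 3‖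
      ≤ 51 * y ^ 4 * u ^ (-(1 : ℝ) / 6) := by
  have h := norm_fwdDiff_three_cpow_sub_le ((23 : ℂ) / 6) hu hy
  have hre : ((23 : ℂ) / 6).re - 4 = -(1 : ℝ) / 6 := by norm_num
  have h1 : ((23 : ℂ) / 6) * ((23 : ℂ) / 6 - 1) * ((23 : ℂ) / 6 - 2) * (u : ℂ) ^ ((23 : ℂ) / 6 - 3) * (y : ℂ) ^ 3 =
      (23 / 6 * (17 / 6) * (11 / 6) : ℂ) * ((u ^ ((5 : ℝ) / 6) : ℝ) : ℂ) * (y : ℂ) ^ 3 := by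
    rw [ofReal_cpow hu.le, show ((23 : ℂ) / 6 - 3) = (((5 : ℝ) / 6 : ℝ) : ℂ) by push_cast; ring]
    ring
  have h2 : ‖((23 : ℂ) / 6) * ((23 : ℂ) / 6 - 1) * ((23 : ℂ) / 6 - 2) * ((23 : ℂ) / 6 - 3)‖ ≤ 17 := by norm_num
  have hmax : max (u ^ (((23 : ℂ) / 6).re - 4)) ((u + 3 * y) ^ (((23 : ℂ) / 6).re - 4)) ≤ u ^ (-(1 : ℝ) / 6) := by
    rw [hre]
    exact max_le le_rfl (Real.rpow_le_rpow_of_nonpos hu (by linarith) (by norm_num))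
  rw [h1] at h
  refine h.trans ?_
  have hu6 : 0 ≤ u ^ (-(1 : ℝ) / 6) := by positivity
  calc 3 * y ^ 4 * (‖((23 : ℂ) / 6) * ((23 : ℂ) / 6 - 1) * ((23 : ℂ) / 6 - 2) * ((23 : ℂ) / 6 - 3)‖ *
        max (u ^ (((23 : ℂ) / 6).re - 4)) ((u + 3 * y) ^ (((23 : ℂ) / 6).re - 4)))
      ≤ 3 * y ^ 4 * (17 * u ^ (-(1 : ℝ) / 6)) := by
        refine mul_le_mul_of_nonneg_left (mul_le_mul h2 hmax ?_ (by norm_num)) (by positivity)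
        exact le_trans (by positivity) (le_max_left _ _)
    _ = 51 * y ^ 4 * u ^ (-(1 : ℝ) / 6) := by ring

/-- `K(5/6) · (23/6)(17/6)(11/6) = 36/5`. [folklore] -/
theorem perronK_five_sixths_mul : perronK (5 / 6) * (23 / 6 * (17 / 6) * (11 / 6) : ℂ) = 36 / 5 := by
  rw [perronK]; norm_num

/-- `‖K(5/6)‖ ≤ 1`. [folklore] -/
theorem norm_perronK_five_sixths_le : ‖perronK (5 / 6)‖ ≤ 1 := by
  rw [perronK]; norm_num


/-! ### Third difference of Landau's identity -/

/-- `Δ³_y` of the right side of `rieszTheta_eq`. [cite: BhargavaTaniguchiThorne2023, §3 proof of Thm 3.1 ("we obtain the three error terms above")] -/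
theorem fwdDiff_three_rieszTheta_eq [NeZero m] (hU : btt_uniformity_sqDvd) {Φ : BinaryCubic (ZMod m) → ℂ}
    (hFE : HasShintaniFE Φ) {ε : ℤ} (hε : ε = 1 ∨ ε = -1) {u y : ℝ} (hu : 0 < u) (hy : 0 ≤ y) :
    ((fwdDiff y)^[3] (rieszTheta ε Φ)) u =
      rhoOne ε Φ / 4 * ((fwdDiff y)^[3] (fun t : ℝ => (t : ℂ) ^ (4 : ℂ))) u
      + rhoFiveSixths ε Φ * perronK (5 / 6) * ((fwdDiff y)^[3] (fun t : ℝ => (t : ℂ) ^ ((23 : ℂ) / 6))) u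
      + thetaCont ε Φ 0 * ((fwdDiff y)^[3] (fun t : ℝ => (t : ℂ) ^ (3 : ℂ))) u
      + 3 * (ε : ℂ) * ((fwdDiff y)^[3] (dualSeries ε Φ)) u := by
  simp only [fwdDiff_iter_three_apply]
  rw [rieszTheta_eq hU hFE hε (X := u + 3 * y) (by linarith), rieszTheta_eq hU hFE hε (X := u + 2 * y) (by linarith),
    rieszTheta_eq hU hFE hε (X := u + y) (by linarith), rieszTheta_eq hU hFE hε hu]
  simp only [dualSeries]
  ring

/-- **`Δ³_y A³_θ(u) = 6y³ (u ρ₁ + (6/5) ρ_{5/6} u^{5/6} + θ_cont(0)) + Err`** with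
`‖Err‖ ≤ 18 y⁴ ‖ρ₁‖ + 51 y⁴ u^{−1/6} ‖ρ_{5/6}‖ + 3 ‖Δ³_y W^ε(u)‖` (`K(5/6)(23/6)(17/6)(11/6) = 36/5`, `|K(5/6)| ≤ 1`).
[cite: BhargavaTaniguchiThorne2023, §3 proof of Thm 3.1 (the main terms X Res₁ + (6/5)·... from the poles, "(eqn:landau)")] -/
theorem norm_fwdDiff_three_rieszTheta_sub_le [NeZero m] (hU : btt_uniformity_sqDvd) {Φ : BinaryCubic (ZMod m) → ℂ}
    (hFE : HasShintaniFE Φ) {ε : ℤ} (hε : ε = 1 ∨ ε = -1) {u y : ℝ} (hu : 0 < u) (hy : 0 ≤ y) :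
    ‖((fwdDiff y)^[3] (rieszTheta ε Φ)) u - ((6 * y ^ 3 : ℝ) : ℂ) *
        ((u : ℂ) * rhoOne ε Φ + 6 / 5 * rhoFiveSixths ε Φ * ((u ^ ((5 : ℝ) / 6) : ℝ) : ℂ) + thetaCont ε Φ 0)‖
      ≤ 18 * y ^ 4 * ‖rhoOne ε Φ‖ + 51 * y ^ 4 * u ^ (-(1 : ℝ) / 6) * ‖rhoFiveSixths ε Φ‖
        + 3 * ‖((fwdDiff y)^[3] (dualSeries ε Φ)) u‖ := by
  set E₄ := ((fwdDiff y)^[3] (fun t : ℝ => (t : ℂ) ^ (4 : ℂ))) u - 24 * (u : ℂ) * (y : ℂ) ^ 3 with hE₄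
  set E₂ := ((fwdDiff y)^[3] (fun t : ℝ => (t : ℂ) ^ ((23 : ℂ) / 6))) u
      - (23 / 6 * (17 / 6) * (11 / 6) : ℂ) * ((u ^ ((5 : ℝ) / 6) : ℝ) : ℂ) * (y : ℂ) ^ 3 with hE₂
  set W := ((fwdDiff y)^[3] (dualSeries ε Φ)) u with hW
  have h4 : ‖E₄‖ ≤ 72 * y ^ 4 := norm_fwdDiff_three_cpow_four_sub_le hu hy
  have h2 : ‖E₂‖ ≤ 51 * y ^ 4 * u ^ (-(1 : ℝ) / 6) := norm_fwdDiff_three_cpow_sub_le' hu hy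
  have hK := perronK_five_sixths_mul
  have e : ((fwdDiff y)^[3] (rieszTheta ε Φ)) u - ((6 * y ^ 3 : ℝ) : ℂ) *
      ((u : ℂ) * rhoOne ε Φ + 6 / 5 * rhoFiveSixths ε Φ * ((u ^ ((5 : ℝ) / 6) : ℝ) : ℂ) + thetaCont ε Φ 0) =
      rhoOne ε Φ / 4 * E₄ + rhoFiveSixths ε Φ * perronK (5 / 6) * E₂ + 3 * (ε : ℂ) * W := by
    rw [fwdDiff_three_rieszTheta_eq hU hFE hε hu hy, fwdDiff_three_cpow_three hu hy, hE₄, hE₂, hW]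
    push_cast
    linear_combination (rhoFiveSixths ε Φ * ((u ^ ((5 : ℝ) / 6) : ℝ) : ℂ) * (y : ℂ) ^ 3) * hK
  rw [e]
  have hεn : ‖(ε : ℂ)‖ = 1 := by rcases hε with rfl | rfl <;> simp
  calc ‖rhoOne ε Φ / 4 * E₄ + rhoFiveSixths ε Φ * perronK (5 / 6) * E₂ + 3 * (ε : ℂ) * W‖
      ≤ ‖rhoOne ε Φ / 4 * E₄‖ + ‖rhoFiveSixths ε Φ * perronK (5 / 6) * E₂‖ + ‖3 * (ε : ℂ) * W‖ := norm_add₃_le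
    _ = ‖rhoOne ε Φ‖ / 4 * ‖E₄‖ + ‖rhoFiveSixths ε Φ‖ * ‖perronK (5 / 6)‖ * ‖E₂‖ + 3 * ‖W‖ := by
        simp only [norm_mul, norm_div, hεn, mul_one]; norm_num
    _ ≤ ‖rhoOne ε Φ‖ / 4 * (72 * y ^ 4) + ‖rhoFiveSixths ε Φ‖ * 1 * (51 * y ^ 4 * u ^ (-(1 : ℝ) / 6)) + 3 * ‖W‖ := by
        gcongr; exact norm_perronK_five_sixths_le
    _ = _ := by ring

/-! ### Nonnegative real `Φ`: real coefficients, and the diagonal combination -/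

/-- The real coefficient sequences `a^s(Φ_m, n)` (real parts). [folklore] -/
def coeffRe (Φ : BinaryCubic (ZMod m) → ℂ) (s : ℤ) (n : ℕ) : ℝ := (shintaniCoeffMod Φ s n).re

/-- For nonnegative real `Φ`, `a^s(Φ_m, n)` is a nonnegative real. [folklore] -/
theorem shintaniCoeffMod_real {Φ : BinaryCubic (ZMod m) → ℂ} (hΦ : ∀ y, 0 ≤ (Φ y).re ∧ (Φ y).im = 0) (s : ℤ) (n : ℕ) :
    0 ≤ (shintaniCoeffMod Φ s n).re ∧ (shintaniCoeffMod Φ s n).im = 0 :=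
  shintaniCoeffWith_re_nonneg (fun _ => hΦ _) _

/-- `a^s(Φ_m, n) = Re a^s(Φ_m, n)` for nonnegative real `Φ`. [folklore] -/
theorem shintaniCoeffMod_eq_coeffRe {Φ : BinaryCubic (ZMod m) → ℂ} (hΦ : ∀ y, 0 ≤ (Φ y).re ∧ (Φ y).im = 0)
    (s : ℤ) (n : ℕ) : shintaniCoeffMod Φ s n = ((coeffRe Φ s n : ℝ) : ℂ) :=
  Complex.ext (by simp [coeffRe]) (by simp [coeffRe, (shintaniCoeffMod_real hΦ s n).2])

/-- `A³_θ = √3 A³⁺ + ε A³⁻` with the REAL Riesz sums `A³^s = rieszThree (a^s)`. [folklore] -/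
theorem rieszTheta_eq_diag {Φ : BinaryCubic (ZMod m) → ℂ} (hΦ : ∀ y, 0 ≤ (Φ y).re ∧ (Φ y).im = 0) (ε : ℤ) (X : ℝ) :
    rieszTheta ε Φ X = (Real.sqrt 3 : ℂ) * ((rieszThree (coeffRe Φ 1) X : ℝ) : ℂ)
      + (ε : ℂ) * ((rieszThree (coeffRe Φ (-1)) X : ℝ) : ℂ) := by
  simp only [rieszTheta, rieszThree, thetaCoeff]
  push_cast
  rw [Finset.mul_sum, Finset.mul_sum, ← Finset.sum_add_distrib]
  refine Finset.sum_congr rfl fun n _ => ?_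
  rw [shintaniCoeffMod_eq_coeffRe hΦ 1 n, shintaniCoeffMod_eq_coeffRe hΦ (-1) n]
  ring

/-- `Δ³ A³_θ = √3 Δ³A³⁺ + ε Δ³A³⁻`. [folklore] -/
theorem fwdDiff_three_rieszTheta_eq_diag {Φ : BinaryCubic (ZMod m) → ℂ} (hΦ : ∀ y, 0 ≤ (Φ y).re ∧ (Φ y).im = 0)
    (ε : ℤ) (u y : ℝ) :
    ((fwdDiff y)^[3] (rieszTheta ε Φ)) u =
      (Real.sqrt 3 : ℂ) * ((((fwdDiff y)^[3] (rieszThree (coeffRe Φ 1))) u : ℝ) : ℂ)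
      + (ε : ℂ) * ((((fwdDiff y)^[3] (rieszThree (coeffRe Φ (-1)))) u : ℝ) : ℂ) := by
  rw [fwdDiff_iter_three_apply, fwdDiff_iter_three_apply_real, fwdDiff_iter_three_apply_real]
  simp only [rieszTheta_eq_diag hΦ]
  push_cast
  ring

/-- The diagonal combination recovering the sign-`s` component from the `ε = ±1` components:
`(z₁ + z₋₁)/(2√3)` for `s = 1`, `(z₁ − z₋₁)/2` otherwise. [cite: BhargavaTaniguchiThorne2023, §2.4 (the matrix T = ((√3, 1), (√3, −1)) of (eq:FE))] -/
def diagComb (s : ℤ) (z₁ z₂ : ℂ) : ℂ := if s = 1 then (z₁ + z₂) / (2 * Real.sqrt 3) else (z₁ - z₂) / 2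

/-- `diagComb s (√3 x₁ + x₋₁) (√3 x₁ − x₋₁) = x_s`. [folklore] -/
theorem diagComb_diag {s : ℤ} (hs : s = 1 ∨ s = -1) (x : ℤ → ℂ) :
    diagComb s ((Real.sqrt 3 : ℂ) * x 1 + ((1 : ℤ) : ℂ) * x (-1)) ((Real.sqrt 3 : ℂ) * x 1 + ((-1 : ℤ) : ℂ) * x (-1)) = x s := by
  have h3 : (Real.sqrt 3 : ℂ) ≠ 0 := by
    exact_mod_cast (Real.sqrt_pos.mpr (by norm_num : (0 : ℝ) < 3)).ne'
  unfold diagComb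
  rcases hs with rfl | rfl
  · rw [if_pos rfl]; push_cast; field_simp; ring
  · rw [if_neg (by norm_num)]; push_cast; ring

/-- Additivity of `diagComb`. [folklore] -/
theorem diagComb_add (s : ℤ) (a₁ a₂ b₁ b₂ : ℂ) :
    diagComb s (a₁ + b₁) (a₂ + b₂) = diagComb s a₁ a₂ + diagComb s b₁ b₂ := by
  unfold diagComb; split_ifs <;> ring

/-- `‖diagComb s z₁ z₂‖ ≤ (‖z₁‖ + ‖z₂‖)/2`. [folklore] -/
theorem norm_diagComb_le (s : ℤ) (z₁ z₂ : ℂ) : ‖diagComb s z₁ z₂‖ ≤ (‖z₁‖ + ‖z₂‖) / 2 := by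
  have h3 : (1 : ℝ) ≤ Real.sqrt 3 := by
    rw [show (1 : ℝ) = Real.sqrt 1 by simp]; exact Real.sqrt_le_sqrt (by norm_num)
  unfold diagComb
  split_ifs
  · rw [norm_div, show (2 * (Real.sqrt 3 : ℂ)) = ((2 * Real.sqrt 3 : ℝ) : ℂ) by push_cast; ring, Complex.norm_real,
      Real.norm_eq_abs, abs_of_pos (by positivity)]
    calc ‖z₁ + z₂‖ / (2 * Real.sqrt 3) ≤ (‖z₁‖ + ‖z₂‖) / (2 * Real.sqrt 3) := by gcongr; exact norm_add_le _ _
      _ ≤ (‖z₁‖ + ‖z₂‖) / 2 := by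
          apply div_le_div_of_nonneg_left (by positivity) (by norm_num); linarith
  · rw [norm_div, show ‖(2 : ℂ)‖ = 2 by simp]
    gcongr; exact norm_sub_le _ _

/-! ### The abstract sandwich step -/

/-- **Landau's sandwich, abstract form.** If `P, P'` are real with `P' ≤ 6y³N ≤ P` and
`P = 6y³(M + θ) + E`, `P' = 6y³(M' + θ) + E'` in `ℂ`, then
`‖N − M‖ ≤ 2‖θ‖ + ‖M − M'‖ + (2‖E‖ + ‖E'‖)/(6y³)`. [cite: LowrydudaTaniguchiThorne2017, §2.2 ((eq:basic_upper)–(eq:basic_lower): the upper and lower bounds from Δ_y^k at X and X − ky)] -/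
theorem norm_sub_le_of_sandwich {N P P' y : ℝ} (hy : 0 < y) {M M' θ E E' : ℂ}
    (hP : (P : ℂ) = ((6 * y ^ 3 : ℝ) : ℂ) * (M + θ) + E) (hP' : (P' : ℂ) = ((6 * y ^ 3 : ℝ) : ℂ) * (M' + θ) + E')
    (hup : 6 * y ^ 3 * N ≤ P) (hlow : P' ≤ 6 * y ^ 3 * N) :
    ‖(N : ℂ) - M‖ ≤ 2 * ‖θ‖ + ‖M - M'‖ + (2 * ‖E‖ + ‖E'‖) / (6 * y ^ 3) := by
  have hc : 0 < 6 * y ^ 3 := by positivity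
  have hre := congrArg Complex.re hP
  have him := congrArg Complex.im hP
  have hre' := congrArg Complex.re hP'
  simp only [ofReal_re, ofReal_im, add_re, add_im, re_ofReal_mul, im_ofReal_mul] at hre him hre'
  -- `N ≤ Re M + Re θ + Re E/(6y³)` and `N ≥ Re M' + Re θ + Re E'/(6y³)`
  have hθ1 : θ.re ≤ ‖θ‖ := re_le_norm θ
  have hθ2 : -‖θ‖ ≤ θ.re := by have := abs_re_le_norm θ; rw [abs_le] at this; exact this.1
  have hθ3 : |θ.im| ≤ ‖θ‖ := abs_im_le_norm θ
  have hE1 : E.re ≤ ‖E‖ := re_le_norm E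
  have hE2 : |E.im| ≤ ‖E‖ := abs_im_le_norm E
  have hE3 : -‖E'‖ ≤ E'.re := by have := abs_re_le_norm E'; rw [abs_le] at this; exact this.1
  have hMM : |(M - M').re| ≤ ‖M - M'‖ := abs_re_le_norm _
  rw [sub_re, abs_le] at hMM
  have hup' : N ≤ M.re + ‖θ‖ + ‖E‖ / (6 * y ^ 3) := by
    have h1 : 6 * y ^ 3 * N ≤ 6 * y ^ 3 * (M.re + θ.re) + E.re := by linarith
    have h2 : N ≤ (M.re + θ.re) + E.re / (6 * y ^ 3) := by
      rw [← sub_le_iff_le_add', le_div_iff₀ hc]; nlinarith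
    have h3 : E.re / (6 * y ^ 3) ≤ ‖E‖ / (6 * y ^ 3) := div_le_div_of_nonneg_right hE1 hc.le
    linarith
  have hlow' : M.re - ‖M - M'‖ - ‖θ‖ - ‖E'‖ / (6 * y ^ 3) ≤ N := by
    have h1 : 6 * y ^ 3 * (M'.re + θ.re) + E'.re ≤ 6 * y ^ 3 * N := by linarith
    have h2 : (M'.re + θ.re) + E'.re / (6 * y ^ 3) ≤ N := by
      rw [← le_sub_iff_add_le', div_le_iff₀ hc]; nlinarith
    have h3 : -‖E'‖ / (6 * y ^ 3) ≤ E'.re / (6 * y ^ 3) := div_le_div_of_nonneg_right hE3 hc.le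
    rw [neg_div] at h3
    linarith
  -- the imaginary part
  have hIm : |M.im| ≤ ‖θ‖ + ‖E‖ / (6 * y ^ 3) := by
    have h1 : 6 * y ^ 3 * (M.im + θ.im) + E.im = 0 := by linarith
    have h2 : M.im = -θ.im - E.im / (6 * y ^ 3) := by field_simp; linarith
    rw [h2, abs_le]
    rw [abs_le] at hθ3 hE2
    have h3 : |E.im / (6 * y ^ 3)| ≤ ‖E‖ / (6 * y ^ 3) := by
      rw [abs_div, abs_of_pos hc]; exact div_le_div_of_nonneg_right (abs_im_le_norm E) hc.le
    rw [abs_le] at h3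
    constructor <;> linarith [h3.1, h3.2]
  -- combine
  have hReIm := norm_le_abs_re_add_abs_im ((N : ℂ) - M)
  simp only [sub_re, ofReal_re, sub_im, ofReal_im, zero_sub, abs_neg] at hReIm
  have hRe : |N - M.re| ≤ ‖θ‖ + ‖M - M'‖ + (‖E‖ + ‖E'‖) / (6 * y ^ 3) := by
    rw [abs_le, add_div]; constructor <;> linarith [div_nonneg (norm_nonneg E) hc.le, div_nonneg (norm_nonneg E') hc.le]
  calc ‖(N : ℂ) - M‖ ≤ |N - M.re| + |M.im| := hReIm
    _ ≤ (‖θ‖ + ‖M - M'‖ + (‖E‖ + ‖E'‖) / (6 * y ^ 3)) + (‖θ‖ + ‖E‖ / (6 * y ^ 3)) := add_le_add hRe hIm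
    _ = 2 * ‖θ‖ + ‖M - M'‖ + (2 * ‖E‖ + ‖E'‖) / (6 * y ^ 3) := by ring

/-- `u^{5/6} − v^{5/6} ≤ (u − v) v^{−1/6}` for `0 < v ≤ u`. [folklore] -/
theorem rpow_five_sixths_sub_le {u v : ℝ} (hv : 0 < v) (hvu : v ≤ u) :
    u ^ ((5 : ℝ) / 6) - v ^ ((5 : ℝ) / 6) ≤ (u - v) * v ^ (-(1 : ℝ) / 6) := by
  have hu : 0 < u := lt_of_lt_of_le hv hvu
  have eu : u ^ ((5 : ℝ) / 6) = u * u ^ (-(1 : ℝ) / 6) := by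
    rw [show (5 : ℝ) / 6 = 1 + -(1 : ℝ) / 6 by norm_num, Real.rpow_add hu, Real.rpow_one]
  have ev : v ^ ((5 : ℝ) / 6) = v * v ^ (-(1 : ℝ) / 6) := by
    rw [show (5 : ℝ) / 6 = 1 + -(1 : ℝ) / 6 by norm_num, Real.rpow_add hv, Real.rpow_one]
  have hle : u ^ (-(1 : ℝ) / 6) ≤ v ^ (-(1 : ℝ) / 6) := Real.rpow_le_rpow_of_nonpos hv hvu (by norm_num)
  rw [eu, ev]
  nlinarith [Real.rpow_nonneg hv.le (-(1 : ℝ) / 6)]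


/-! ### The `y`-form of Theorem 3.1 (weak, Bessel-free), per `Φ` -/

/-- `v^{−1/6} ≤ 2 u^{−1/6}` for `u/2 ≤ v`. [folklore] -/
theorem rpow_neg_sixth_le {u v : ℝ} (hu : 0 < u) (huv : u / 2 ≤ v) : v ^ (-(1 : ℝ) / 6) ≤ 2 * u ^ (-(1 : ℝ) / 6) := by
  have h2 : 0 < u / 2 := by positivity
  calc v ^ (-(1 : ℝ) / 6) ≤ (u / 2) ^ (-(1 : ℝ) / 6) := Real.rpow_le_rpow_of_nonpos h2 huv (by norm_num)
    _ = u ^ (-(1 : ℝ) / 6) * (2 : ℝ) ^ ((1 : ℝ) / 6) := by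
        rw [Real.div_rpow hu.le (by norm_num), show (-(1 : ℝ) / 6) = -((1 : ℝ) / 6) by ring,
          Real.rpow_neg (by norm_num : (0 : ℝ) ≤ 2), div_inv_eq_mul]
    _ ≤ u ^ (-(1 : ℝ) / 6) * 2 := by
        gcongr
        calc (2 : ℝ) ^ ((1 : ℝ) / 6) ≤ 2 ^ (1 : ℝ) := Real.rpow_le_rpow_of_exponent_le (by norm_num) (by norm_num)
          _ = 2 := Real.rpow_one 2
    _ = 2 * u ^ (-(1 : ℝ) / 6) := by ring

/-- **BTT Theorem 3.1 in `y`-form (weak, Bessel-free), uniformly in the level.** For `0 < η ≤ 1/16` there is `C_η`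
such that for every `m ≥ 1`, every nonnegative real `Φ : V(ℤ/mℤ) → ℂ` satisfying the functional-equation schema,
`s = ±1`, and `0 < y`, `6y ≤ u`:
`|Σ_{n ≤ u} a^s(Φ_m, n) − Res₁ξ^s · u − (6/5) Res_{5/6}ξ^s · u^{5/6}|
   ≤ C_η [ y Σ_±|Res₁ξ^±| + y u^{−1/6} Σ_±|Res_{5/6}ξ^±| + δ̂₁(Φ_m)(1 + u^{2+4η} y^{−2−4η}) ]`
(Landau's method as in [LDTT] §2: third differences of `rieszTheta_eq` at `u` and `u − 3y`, the sandwich for the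
nonnegative coefficients, the diagonalisation `T` undone; BTT/LDTT then optimise `y`).
[cite: BhargavaTaniguchiThorne2023, Thm 3.1 (proof, §3) with LowrydudaTaniguchiThorne2017 §2.2 (eq:basic_upper)–(eq:def_E)] -/
theorem exists_landau_yform_real (hU : btt_uniformity_sqDvd) {η : ℝ} (hη0 : 0 < η) (hη1 : η ≤ 1 / 16) :
    ∃ C : ℝ, 0 < C ∧ ∀ (m : ℕ) [NeZero m] (Φ : BinaryCubic (ZMod m) → ℂ),
      (∀ v, 0 ≤ (Φ v).re ∧ (Φ v).im = 0) → HasShintaniFE Φ →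
      ∀ s : ℤ, (s = 1 ∨ s = -1) → ∀ u y : ℝ, 0 < y → 6 * y ≤ u →
        ‖(∑ n ∈ Finset.Ioc 0 ⌊u⌋₊, shintaniCoeffMod Φ s n) - (u : ℂ) * shintaniRes1 Φ s
            - 6 / 5 * shintaniRes56 Φ s * ((u ^ ((5 : ℝ) / 6) : ℝ) : ℂ)‖
          ≤ C * (y * (‖shintaniRes1 Φ 1‖ + ‖shintaniRes1 Φ (-1)‖)
              + y * u ^ (-(1 : ℝ) / 6) * (‖shintaniRes56 Φ 1‖ + ‖shintaniRes56 Φ (-1)‖)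
              + dualDensity Φ * (1 + u ^ (2 + 4 * η) * y ^ (-(2 + 4 * η)))) := by
  obtain ⟨Cθ, hCθ, hθ0⟩ := exists_norm_thetaCont_zero_le hU
  obtain ⟨CW, hCW, hW⟩ := exists_norm_fwdDiff_three_dualSeries_le hU hη0 hη1
  refine ⟨2 * Cθ + 2 * CW + 120, by positivity, ?_⟩
  intro m _ Φ hΦ hFE s hs u y hy hyu
  have hu : 0 < u := by linarith
  have hu'0 : 0 < u - 3 * y := by linarith
  have hu'u : u - 3 * y ≤ u := by linarith
  have hu'2 : u / 2 ≤ u - 3 * y := by linarith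
  have h3 : (Real.sqrt 3 : ℂ) ≠ 0 := by exact_mod_cast (Real.sqrt_pos.mpr (by norm_num : (0 : ℝ) < 3)).ne'
  have hsqrt : Real.sqrt 3 ≤ 2 := by
    rw [show (2 : ℝ) = Real.sqrt 4 by rw [show (4 : ℝ) = 2 ^ 2 by norm_num, Real.sqrt_sq zero_le_two]]
    exact Real.sqrt_le_sqrt (by norm_num)
  set R₁ : ℝ := ‖shintaniRes1 Φ 1‖ + ‖shintaniRes1 Φ (-1)‖ with hR₁
  set R₂ : ℝ := ‖shintaniRes56 Φ 1‖ + ‖shintaniRes56 Φ (-1)‖ with hR₂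
  set D : ℝ := dualDensity Φ with hD
  have hD0 : 0 ≤ D := dualDensity_nonneg Φ
  have hR₁0 : 0 ≤ R₁ := by positivity
  have hR₂0 : 0 ≤ R₂ := by positivity
  set M : ℝ → ℂ := fun v => (v : ℂ) * shintaniRes1 Φ s + 6 / 5 * shintaniRes56 Φ s * ((v ^ ((5 : ℝ) / 6) : ℝ) : ℂ)
    with hM
  set θc : ℂ := diagComb s (thetaCont 1 Φ 0) (thetaCont (-1) Φ 0) with hθc
  set V : ℤ → ℝ → ℂ := fun ε v => ((fwdDiff y)^[3] (rieszTheta ε Φ)) v with hV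
  set mainT : ℤ → ℝ → ℂ := fun ε v => ((6 * y ^ 3 : ℝ) : ℂ) *
    ((v : ℂ) * rhoOne ε Φ + 6 / 5 * rhoFiveSixths ε Φ * ((v ^ ((5 : ℝ) / 6) : ℝ) : ℂ) + thetaCont ε Φ 0) with hmainT
  set Err : ℤ → ℝ → ℂ := fun ε v => V ε v - mainT ε v with hErr
  set P : ℝ → ℝ := fun v => ((fwdDiff y)^[3] (rieszThree (coeffRe Φ s))) v with hP
  -- (1) the real third differences through the diagonal components
  have hPdiag : ∀ v, (P v : ℂ) = diagComb s (V 1 v) (V (-1) v) := by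
    intro v
    have h1 := fwdDiff_three_rieszTheta_eq_diag hΦ 1 v y
    have h2 := fwdDiff_three_rieszTheta_eq_diag hΦ (-1) v y
    simp only [hV, hP]
    rw [h1, h2]
    exact (diagComb_diag hs (fun t => ((((fwdDiff y)^[3] (rieszThree (coeffRe Φ t))) v : ℝ) : ℂ))).symm
  -- (2) the main terms recombine
  have hmain : ∀ v, diagComb s (mainT 1 v) (mainT (-1) v) = ((6 * y ^ 3 : ℝ) : ℂ) * (M v + θc) := by
    intro v
    simp only [hmainT, hM, hθc, rhoOne, rhoFiveSixths, diagComb]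
    rcases hs with rfl | rfl
    · simp only [if_true]; push_cast; field_simp; ring
    · simp only [show (-1 : ℤ) ≠ 1 by norm_num, if_false]; push_cast; ring
  -- (3) the error terms
  have hρ₁ : ∀ ε : ℤ, (ε = 1 ∨ ε = -1) → ‖rhoOne ε Φ‖ ≤ 2 * R₁ := by
    intro ε hε
    have hεn : ‖(ε : ℂ)‖ = 1 := by rcases hε with rfl | rfl <;> simp
    calc ‖rhoOne ε Φ‖ ≤ ‖(Real.sqrt 3 : ℂ)‖ * ‖shintaniRes1 Φ 1‖ + ‖(ε : ℂ)‖ * ‖shintaniRes1 Φ (-1)‖ := by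
          unfold rhoOne; exact (norm_add_le _ _).trans (by rw [norm_mul, norm_mul])
      _ ≤ 2 * ‖shintaniRes1 Φ 1‖ + 1 * ‖shintaniRes1 Φ (-1)‖ := by
          rw [hεn, Complex.norm_real, Real.norm_eq_abs, abs_of_nonneg (Real.sqrt_nonneg _)]; gcongr
      _ ≤ 2 * R₁ := by rw [hR₁]; linarith [norm_nonneg (shintaniRes1 Φ (-1))]
  have hρ₂ : ∀ ε : ℤ, (ε = 1 ∨ ε = -1) → ‖rhoFiveSixths ε Φ‖ ≤ 2 * R₂ := by
    intro ε hε
    have hεn : ‖(ε : ℂ)‖ = 1 := by rcases hε with rfl | rfl <;> simp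
    calc ‖rhoFiveSixths ε Φ‖ ≤ ‖(Real.sqrt 3 : ℂ)‖ * ‖shintaniRes56 Φ 1‖ + ‖(ε : ℂ)‖ * ‖shintaniRes56 Φ (-1)‖ := by
          unfold rhoFiveSixths; exact (norm_add_le _ _).trans (by rw [norm_mul, norm_mul])
      _ ≤ 2 * ‖shintaniRes56 Φ 1‖ + 1 * ‖shintaniRes56 Φ (-1)‖ := by
          rw [hεn, Complex.norm_real, Real.norm_eq_abs, abs_of_nonneg (Real.sqrt_nonneg _)]; gcongr
      _ ≤ 2 * R₂ := by rw [hR₂]; linarith [norm_nonneg (shintaniRes56 Φ (-1))]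
  set B : ℝ := 36 * y ^ 4 * R₁ + 204 * y ^ 4 * u ^ (-(1 : ℝ) / 6) * R₂ + 3 * CW * D * u ^ (2 + 4 * η) * y ^ (1 - 4 * η)
    with hB
  have hErr : ∀ ε : ℤ, (ε = 1 ∨ ε = -1) → ∀ v, 3 * y ≤ v → v ≤ u → u / 2 ≤ v → ‖Err ε v‖ ≤ B := by
    intro ε hε v hv hvu hv2
    have hv0 : 0 < v := by linarith
    have h := norm_fwdDiff_three_rieszTheta_sub_le hU hFE hε hv0 hy.le
    have hWv := hW m Φ ε hε v y hy hv
    have hv6 := rpow_neg_sixth_le hu hv2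
    have hvpow : v ^ (2 + 4 * η) ≤ u ^ (2 + 4 * η) := Real.rpow_le_rpow hv0.le hvu (by positivity)
    have h1 := hρ₁ ε hε
    have h2 := hρ₂ ε hε
    calc ‖Err ε v‖ ≤ 18 * y ^ 4 * ‖rhoOne ε Φ‖ + 51 * y ^ 4 * v ^ (-(1 : ℝ) / 6) * ‖rhoFiveSixths ε Φ‖
          + 3 * ‖((fwdDiff y)^[3] (dualSeries ε Φ)) v‖ := h
      _ ≤ 18 * y ^ 4 * (2 * R₁) + 51 * y ^ 4 * (2 * u ^ (-(1 : ℝ) / 6)) * (2 * R₂)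
          + 3 * (CW * D * u ^ (2 + 4 * η) * y ^ (1 - 4 * η)) := by
          gcongr
          exact hWv.trans (by gcongr)
      _ = B := by rw [hB]; ring
  -- (4) the sandwich
  have ha : ∀ n, 0 ≤ coeffRe Φ s n := fun n => (shintaniCoeffMod_real hΦ s n).1
  set N : ℝ := ∑ n ∈ Finset.Ioc 0 ⌊u⌋₊, coeffRe Φ s n with hN
  have hup : 6 * y ^ 3 * N ≤ P u := (riesz_three_sandwich ha hu.le hy.le).1
  have hlow : P (u - 3 * y) ≤ 6 * y ^ 3 * N := by
    have h := (riesz_three_sandwich ha hu'0.le hy.le (a := coeffRe Φ s)).2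
    rwa [sub_add_cancel] at h
  have hErrdef : ∀ ε v, Err ε v = V ε v - mainT ε v := fun ε v => rfl
  have hVsplit : ∀ ε v, V ε v = mainT ε v + Err ε v := fun ε v => by rw [hErrdef]; ring
  have hPu : ((P u : ℝ) : ℂ) = ((6 * y ^ 3 : ℝ) : ℂ) * (M u + θc) + diagComb s (Err 1 u) (Err (-1) u) := by
    rw [hPdiag, hVsplit 1 u, hVsplit (-1) u, diagComb_add, hmain]
  have hPu' : ((P (u - 3 * y) : ℝ) : ℂ) = ((6 * y ^ 3 : ℝ) : ℂ) * (M (u - 3 * y) + θc)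
      + diagComb s (Err 1 (u - 3 * y)) (Err (-1) (u - 3 * y)) := by
    rw [hPdiag, hVsplit 1 (u - 3 * y), hVsplit (-1) (u - 3 * y), diagComb_add, hmain]
  have hcore := norm_sub_le_of_sandwich hy hPu hPu' hup hlow
  -- (5) the individual bounds
  have hθc' : ‖θc‖ ≤ Cθ * D := by
    refine (norm_diagComb_le s _ _).trans ?_
    have h1 := hθ0 m Φ hFE 1 (Or.inl rfl)
    have h2 := hθ0 m Φ hFE (-1) (Or.inr rfl)
    rw [← hD] at h1 h2
    linarith
  have hE : ‖diagComb s (Err 1 u) (Err (-1) u)‖ ≤ B := by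
    refine (norm_diagComb_le s _ _).trans ?_
    have h1 := hErr 1 (Or.inl rfl) u (by linarith) le_rfl (by linarith)
    have h2 := hErr (-1) (Or.inr rfl) u (by linarith) le_rfl (by linarith)
    linarith
  have hE' : ‖diagComb s (Err 1 (u - 3 * y)) (Err (-1) (u - 3 * y))‖ ≤ B := by
    refine (norm_diagComb_le s _ _).trans ?_
    have h1 := hErr 1 (Or.inl rfl) (u - 3 * y) (by linarith) hu'u hu'2
    have h2 := hErr (-1) (Or.inr rfl) (u - 3 * y) (by linarith) hu'u hu'2
    linarith
  have hrs₁ : ‖shintaniRes1 Φ s‖ ≤ R₁ := by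
    rcases hs with rfl | rfl
    · exact le_add_of_nonneg_right (norm_nonneg _)
    · exact le_add_of_nonneg_left (norm_nonneg _)
  have hrs₂ : ‖shintaniRes56 Φ s‖ ≤ R₂ := by
    rcases hs with rfl | rfl
    · exact le_add_of_nonneg_right (norm_nonneg _)
    · exact le_add_of_nonneg_left (norm_nonneg _)
  have hMM : ‖M u - M (u - 3 * y)‖ ≤ 3 * y * R₁ + 36 / 5 * y * u ^ (-(1 : ℝ) / 6) * R₂ := by
    have hdiff : M u - M (u - 3 * y) = ((3 * y : ℝ) : ℂ) * shintaniRes1 Φ s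
        + 6 / 5 * shintaniRes56 Φ s * ((u ^ ((5 : ℝ) / 6) - (u - 3 * y) ^ ((5 : ℝ) / 6) : ℝ) : ℂ) := by
      simp only [hM]; push_cast; ring
    have hpow : |u ^ ((5 : ℝ) / 6) - (u - 3 * y) ^ ((5 : ℝ) / 6)| ≤ 3 * y * (2 * u ^ (-(1 : ℝ) / 6)) := by
      rw [abs_of_nonneg (sub_nonneg.mpr (Real.rpow_le_rpow hu'0.le hu'u (by norm_num)))]
      calc u ^ ((5 : ℝ) / 6) - (u - 3 * y) ^ ((5 : ℝ) / 6) ≤ (u - (u - 3 * y)) * (u - 3 * y) ^ (-(1 : ℝ) / 6) :=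
            rpow_five_sixths_sub_le hu'0 hu'u
        _ = 3 * y * (u - 3 * y) ^ (-(1 : ℝ) / 6) := by ring
        _ ≤ 3 * y * (2 * u ^ (-(1 : ℝ) / 6)) := by gcongr; exact rpow_neg_sixth_le hu hu'2
    rw [hdiff]
    calc ‖((3 * y : ℝ) : ℂ) * shintaniRes1 Φ s + 6 / 5 * shintaniRes56 Φ s * ((u ^ ((5 : ℝ) / 6) - (u - 3 * y) ^ ((5 : ℝ) / 6) : ℝ) : ℂ)‖
        ≤ ‖((3 * y : ℝ) : ℂ) * shintaniRes1 Φ s‖ + ‖(6 / 5 : ℂ) * shintaniRes56 Φ s * ((u ^ ((5 : ℝ) / 6) - (u - 3 * y) ^ ((5 : ℝ) / 6) : ℝ) : ℂ)‖ :=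
          norm_add_le _ _
      _ = 3 * y * ‖shintaniRes1 Φ s‖ + 6 / 5 * ‖shintaniRes56 Φ s‖ * |u ^ ((5 : ℝ) / 6) - (u - 3 * y) ^ ((5 : ℝ) / 6)| := by
          rw [norm_mul, norm_mul, norm_mul, Complex.norm_real, Complex.norm_real, Real.norm_eq_abs, Real.norm_eq_abs,
            abs_of_pos (by positivity : 0 < 3 * y)]
          norm_num
      _ ≤ 3 * y * R₁ + 6 / 5 * R₂ * (3 * y * (2 * u ^ (-(1 : ℝ) / 6))) := by gcongr
      _ = 3 * y * R₁ + 36 / 5 * y * u ^ (-(1 : ℝ) / 6) * R₂ := by ring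
  -- (6) assemble
  have hsum_cast : (∑ n ∈ Finset.Ioc 0 ⌊u⌋₊, shintaniCoeffMod Φ s n) = ((N : ℝ) : ℂ) := by
    rw [hN]; push_cast; exact Finset.sum_congr rfl fun n _ => shintaniCoeffMod_eq_coeffRe hΦ s n
  have hMu : (u : ℂ) * shintaniRes1 Φ s + 6 / 5 * shintaniRes56 Φ s * ((u ^ ((5 : ℝ) / 6) : ℝ) : ℂ) = M u := rfl
  rw [hsum_cast, sub_sub, hMu]
  have hy3 : 0 < 6 * y ^ 3 := by positivity
  have hBdiv : (2 * B + B) / (6 * y ^ 3) = 18 * y * R₁ + 102 * y * u ^ (-(1 : ℝ) / 6) * R₂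
      + 3 / 2 * CW * D * (u ^ (2 + 4 * η) * y ^ (-(2 + 4 * η))) := by
    rw [hB]
    have e1 : y ^ (1 - 4 * η) = y ^ 3 * y ^ (-(2 + 4 * η)) := by
      rw [show (y ^ 3 : ℝ) = y ^ (3 : ℝ) by norm_cast, ← Real.rpow_add hy]; congr 1; ring
    rw [e1]
    field_simp
    ring
  have hfinal : 2 * ‖θc‖ + ‖M u - M (u - 3 * y)‖ + (2 * ‖diagComb s (Err 1 u) (Err (-1) u)‖
      + ‖diagComb s (Err 1 (u - 3 * y)) (Err (-1) (u - 3 * y))‖) / (6 * y ^ 3)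
      ≤ 2 * (Cθ * D) + (3 * y * R₁ + 36 / 5 * y * u ^ (-(1 : ℝ) / 6) * R₂) + (2 * B + B) / (6 * y ^ 3) := by
    gcongr
  rw [hBdiv] at hfinal
  refine hcore.trans (hfinal.trans ?_)
  set u6 : ℝ := u ^ (-(1 : ℝ) / 6) with hu6
  set UY : ℝ := u ^ (2 + 4 * η) * y ^ (-(2 + 4 * η)) with hUY
  have hu60 : 0 ≤ u6 := by positivity
  have hUY0 : 0 ≤ UY := by positivity
  have hyu6 : 0 ≤ y * u6 * R₂ := by positivity
  have hyR : 0 ≤ y * R₁ := by positivity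
  have hDP : 0 ≤ D * UY := by positivity
  have k1 := mul_nonneg hCθ.le hD0
  have k2 := mul_nonneg hCW.le hDP
  have k3 := mul_nonneg hCθ.le hyR
  have k4 := mul_nonneg hCW.le hyR
  have k5 := mul_nonneg hCθ.le hyu6
  have k6 := mul_nonneg hCW.le hyu6
  have k7 := mul_nonneg hCθ.le hDP
  have k8 := mul_nonneg hCW.le hD0
  have e : (2 * Cθ + 2 * CW + 120) * (y * R₁ + y * u6 * R₂ + D * (1 + UY)) =
      2 * (Cθ * (y * R₁)) + 2 * (CW * (y * R₁)) + 120 * (y * R₁) + 2 * (Cθ * (y * u6 * R₂)) + 2 * (CW * (y * u6 * R₂))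
      + 120 * (y * u6 * R₂) + 2 * (Cθ * D) + 2 * (CW * D) + 120 * D + 2 * (Cθ * (D * UY)) + 2 * (CW * (D * UY))
      + 120 * (D * UY) := by ring
  rw [e]
  have e2 : 2 * (Cθ * D) + (3 * y * R₁ + 36 / 5 * y * u6 * R₂) + (18 * y * R₁ + 102 * y * u6 * R₂ + 3 / 2 * CW * D * UY) =
      2 * (Cθ * D) + 21 * (y * R₁) + (546 / 5) * (y * u6 * R₂) + 3 / 2 * (CW * (D * UY)) := by ring
  rw [e2]
  linarith


/-! ### At integer `X`: the statement for `N^s(X, Φ_m) = Σ_{n<X} a^s(Φ_m, n)` -/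

/-- `Σ_{0 < n ≤ ⌊X − 1/2⌋} a^s(Φ_m, n) = N^s(X, Φ_m)` for an integer `X ≥ 1`. [folklore] -/
theorem sum_Ioc_floor_eq_shintaniPartialSum (Φ : BinaryCubic (ZMod m) → ℂ) (s : ℤ) {X : ℕ} (hX : 1 ≤ X) :
    (∑ n ∈ Finset.Ioc 0 ⌊(X : ℝ) - 1 / 2⌋₊, shintaniCoeffMod Φ s n) = shintaniPartialSum Φ s (X : ℝ) := by
  rw [shintaniPartialSum_natCast]
  have hX1 : (1 : ℝ) ≤ X := by exact_mod_cast hX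
  have hfl : ⌊(X : ℝ) - 1 / 2⌋₊ = X - 1 := by
    rw [Nat.floor_eq_iff (by linarith), Nat.cast_sub hX]
    push_cast
    constructor <;> linarith
  rw [hfl]
  refine Finset.sum_congr ?_ (fun _ _ => rfl)
  ext n
  simp only [Finset.mem_Ioc, Finset.mem_Ico]
  omega

/-- **BTT Theorem 3.1, `y`-form (weak, Bessel-free), at integer `X`, uniformly in the level `m`.** For
`0 < η ≤ 1/16` there is `C_η` such that for all `m ≥ 1`, all nonnegative real `Φ : V(ℤ/mℤ) → ℂ` satisfying the
functional-equation schema `HasShintaniFE Φ`, `s = ±1`, integers `X ≥ 1` and `0 < y ≤ X/12`: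
`|N^s(X, Φ_m) − Res₁ξ^s(Φ_m)·X − (6/5)Res_{5/6}ξ^s(Φ_m)·X^{5/6}|
  ≤ C_η [ (y+1) Σ_±|Res₁ξ^±| + (y+1) X^{−1/6} Σ_±|Res_{5/6}ξ^±| + δ̂₁(Φ_m) (1 + X^{2+4η} y^{−(2+4η)}) ]`.
With `y ≍ (δ̂₁/δ₁)^{1/3} X^{2/3}` this is Theorem 3.1 with the exponents `(2/5, 3/5, 3/5)` replaced by
`(1/3, 2/3, 2/3) + O(η)`; cf. BTT: "in the range `δ₁(Φ)X^{13/16} < δ̂₁(Φ)` … (eqn:landau) is worse than the trivial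
bound" — here likewise the consumer (§5) only needs the averaged consequence `O(X^{2/3+ε})`.
[cite: BhargavaTaniguchiThorne2023, Thm 3.1 (statement (eqn:landau) and its proof, §3)] -/
theorem exists_landau_yform (hU : btt_uniformity_sqDvd) {η : ℝ} (hη0 : 0 < η) (hη1 : η ≤ 1 / 16) :
    ∃ C : ℝ, 0 < C ∧ ∀ (m : ℕ) [NeZero m] (Φ : BinaryCubic (ZMod m) → ℂ),
      (∀ v, 0 ≤ (Φ v).re ∧ (Φ v).im = 0) → HasShintaniFE Φ →
      ∀ s : ℤ, (s = 1 ∨ s = -1) → ∀ (X : ℕ) (y : ℝ), 1 ≤ X → 0 < y → 12 * y ≤ X →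
        ‖shintaniPartialSum Φ s (X : ℝ) - shintaniRes1 Φ s * ((X : ℝ) : ℂ)
            - (6 / 5 : ℂ) * shintaniRes56 Φ s * ((((X : ℝ)) ^ ((5 : ℝ) / 6) : ℝ) : ℂ)‖
          ≤ C * ((y + 1) * (‖shintaniRes1 Φ 1‖ + ‖shintaniRes1 Φ (-1)‖)
              + (y + 1) * (X : ℝ) ^ (-(1 : ℝ) / 6) * (‖shintaniRes56 Φ 1‖ + ‖shintaniRes56 Φ (-1)‖)
              + dualDensity Φ * (1 + (X : ℝ) ^ (2 + 4 * η) * y ^ (-(2 + 4 * η)))) := by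
  obtain ⟨C, hC, h⟩ := exists_landau_yform_real hU hη0 hη1
  refine ⟨2 * C + 2, by positivity, ?_⟩
  intro m _ Φ hΦ hFE s hs X y hX hy hyX
  have hX1 : (1 : ℝ) ≤ X := by exact_mod_cast hX
  have hX0 : (0 : ℝ) < X := by linarith
  have hu0 : 0 < (X : ℝ) - 1 / 2 := by linarith
  have huX : (X : ℝ) - 1 / 2 ≤ X := by linarith
  have hXu : (X : ℝ) / 2 ≤ (X : ℝ) - 1 / 2 := by linarith
  have hyu : 6 * y ≤ (X : ℝ) - 1 / 2 := by linarith
  have hmain := h m Φ hΦ hFE s hs ((X : ℝ) - 1 / 2) y hy hyu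
  rw [sum_Ioc_floor_eq_shintaniPartialSum Φ s hX] at hmain
  set R₁ : ℝ := ‖shintaniRes1 Φ 1‖ + ‖shintaniRes1 Φ (-1)‖ with hR₁
  set R₂ : ℝ := ‖shintaniRes56 Φ 1‖ + ‖shintaniRes56 Φ (-1)‖ with hR₂
  set D : ℝ := dualDensity Φ with hD
  have hD0 : 0 ≤ D := dualDensity_nonneg Φ
  have hrs₁ : ‖shintaniRes1 Φ s‖ ≤ R₁ := by
    rcases hs with rfl | rfl
    · exact le_add_of_nonneg_right (norm_nonneg _)
    · exact le_add_of_nonneg_left (norm_nonneg _)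
  have hrs₂ : ‖shintaniRes56 Φ s‖ ≤ R₂ := by
    rcases hs with rfl | rfl
    · exact le_add_of_nonneg_right (norm_nonneg _)
    · exact le_add_of_nonneg_left (norm_nonneg _)
  have hu6 := rpow_neg_sixth_le hX0 hXu
  have hupow : ((X : ℝ) - 1 / 2) ^ (2 + 4 * η) ≤ (X : ℝ) ^ (2 + 4 * η) := Real.rpow_le_rpow hu0.le huX (by positivity)
  -- the main terms at `X` versus `X − 1/2`
  have hpow : |(X : ℝ) ^ ((5 : ℝ) / 6) - ((X : ℝ) - 1 / 2) ^ ((5 : ℝ) / 6)| ≤ (X : ℝ) ^ (-(1 : ℝ) / 6) := by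
    rw [abs_of_nonneg (sub_nonneg.mpr (Real.rpow_le_rpow hu0.le huX (by norm_num)))]
    calc (X : ℝ) ^ ((5 : ℝ) / 6) - ((X : ℝ) - 1 / 2) ^ ((5 : ℝ) / 6)
        ≤ ((X : ℝ) - ((X : ℝ) - 1 / 2)) * ((X : ℝ) - 1 / 2) ^ (-(1 : ℝ) / 6) := rpow_five_sixths_sub_le hu0 huX
      _ = 1 / 2 * ((X : ℝ) - 1 / 2) ^ (-(1 : ℝ) / 6) := by ring
      _ ≤ 1 / 2 * (2 * (X : ℝ) ^ (-(1 : ℝ) / 6)) := by gcongr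
      _ = (X : ℝ) ^ (-(1 : ℝ) / 6) := by ring
  have hdec : shintaniPartialSum Φ s (X : ℝ) - shintaniRes1 Φ s * ((X : ℝ) : ℂ)
      - (6 / 5 : ℂ) * shintaniRes56 Φ s * ((((X : ℝ)) ^ ((5 : ℝ) / 6) : ℝ) : ℂ)
      = (shintaniPartialSum Φ s (X : ℝ) - (((X : ℝ) - 1 / 2 : ℝ) : ℂ) * shintaniRes1 Φ s
          - 6 / 5 * shintaniRes56 Φ s * ((((X : ℝ) - 1 / 2) ^ ((5 : ℝ) / 6) : ℝ) : ℂ))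
        - (((1 / 2 : ℝ) : ℂ) * shintaniRes1 Φ s + (6 / 5 : ℂ) * shintaniRes56 Φ s *
            (((X : ℝ) ^ ((5 : ℝ) / 6) - ((X : ℝ) - 1 / 2) ^ ((5 : ℝ) / 6) : ℝ) : ℂ)) := by
    push_cast; ring
  rw [hdec]
  refine (norm_sub_le _ _).trans ?_
  have hextra : ‖((1 / 2 : ℝ) : ℂ) * shintaniRes1 Φ s + (6 / 5 : ℂ) * shintaniRes56 Φ s *
      (((X : ℝ) ^ ((5 : ℝ) / 6) - ((X : ℝ) - 1 / 2) ^ ((5 : ℝ) / 6) : ℝ) : ℂ)‖ ≤ 1 / 2 * R₁ + 6 / 5 * R₂ * (X : ℝ) ^ (-(1 : ℝ) / 6) := by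
    refine (norm_add_le _ _).trans ?_
    rw [norm_mul, norm_mul, norm_mul, Complex.norm_real, Complex.norm_real, Real.norm_eq_abs, Real.norm_eq_abs,
      abs_of_pos (by norm_num : (0 : ℝ) < 1 / 2)]
    have : ‖(6 / 5 : ℂ)‖ = 6 / 5 := by norm_num
    rw [this]
    gcongr
  have hmain' := hmain.trans (show C * (y * R₁ + y * ((X : ℝ) - 1 / 2) ^ (-(1 : ℝ) / 6) * R₂
      + D * (1 + ((X : ℝ) - 1 / 2) ^ (2 + 4 * η) * y ^ (-(2 + 4 * η))))
      ≤ C * (y * R₁ + y * (2 * (X : ℝ) ^ (-(1 : ℝ) / 6)) * R₂ + D * (1 + (X : ℝ) ^ (2 + 4 * η) * y ^ (-(2 + 4 * η)))) by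
    gcongr)
  refine (add_le_add hmain' hextra).trans ?_
  set x6 : ℝ := (X : ℝ) ^ (-(1 : ℝ) / 6) with hx6
  set UY : ℝ := (X : ℝ) ^ (2 + 4 * η) * y ^ (-(2 + 4 * η)) with hUY
  have hx60 : 0 ≤ x6 := by positivity
  have hUY0 : 0 ≤ UY := by positivity
  have hR₁0 : 0 ≤ R₁ := by positivity
  have hR₂0 : 0 ≤ R₂ := by positivity
  have k1 : 0 ≤ C * (y * R₁) := by positivity
  have k2 : 0 ≤ C * (y * x6 * R₂) := by positivity
  have k3 : 0 ≤ C * (x6 * R₂) := by positivity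
  have k4 : 0 ≤ C * R₁ := by positivity
  have k5 : 0 ≤ C * (D * UY) := by positivity
  have k6 : 0 ≤ C * D := by positivity
  have k7 : 0 ≤ y * R₁ := by positivity
  have k8 : 0 ≤ y * x6 * R₂ := by positivity
  have k9 : 0 ≤ D * UY := by positivity
  have e : (2 * C + 2) * ((y + 1) * R₁ + (y + 1) * x6 * R₂ + D * (1 + UY)) =
      2 * (C * (y * R₁)) + 2 * (C * R₁) + 2 * (y * R₁) + 2 * R₁ + 2 * (C * (y * x6 * R₂)) + 2 * (C * (x6 * R₂))
      + 2 * (y * x6 * R₂) + 2 * (x6 * R₂) + 2 * (C * D) + 2 * D + 2 * (C * (D * UY)) + 2 * (D * UY) := by ring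
  have e2 : C * (y * R₁ + y * (2 * x6) * R₂ + D * (1 + UY)) + (1 / 2 * R₁ + 6 / 5 * R₂ * x6) =
      C * (y * R₁) + 2 * (C * (y * x6 * R₂)) + C * D + C * (D * UY) + 1 / 2 * R₁ + 6 / 5 * (x6 * R₂) := by ring
  rw [e, e2]
  have k10 : 0 ≤ x6 * R₂ := by positivity
  linarith

end LandauShintani

end Literature.NumberTheory.CubicFields

end
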